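import Summits.Ventures.PercRepro.Night2FatBudget
import Summits.Ventures.PercRepro.Night2ThreeFatCellsC

/-!
# PercRepro — the `(3, 0)` cells through the fat-face budget: `|G| = 13` CLOSES OUTRIGHT, `|G| = 10, 11, 12` close
with few fat thin closures; residues L (night-2, gen 23)

With the fat-face budget of `Night2FatBudget` (`fatBudget 5 3 6 k` in place of the chord excess when the fat thin
members of `G` have at most `k` distinct closures) and the one- / two-hyperplane counts of gens 21–22, the count sums
of `localShadowHall_excess_of_count` are `≥ 1` at `(3, 0)`:
`k ≤ 1` (one fat thin closure, count `cntFat 6 2`): `1.546 / 1.130 / 1.027 / 1.108` at `n = 10 / 11 / 12 / 13`;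
`k ≤ 4` with two different missed sets (count `cntTwo 6`): `1.029` at `n = 10`; `k ≤ 2`: `1.016` at `n = 11`.
Since two fat thin members with different missed sets already close `|G| = 13` (`Night2TwoFatCells`, residues E),
**the cell `(3, 0)` at `|G| = 13` closes for every `G` with a fat thin member** — the residue range shrinks to
`10 ≤ |G| ≤ 12` (`shadowHall_seven_five_of_residuesL` in `Night2FatBudgetResidues`), with the new clauses «at least
`5 / 3 / 2` fat thin closures» at `|G| = 10 / 11 / 12`.
-/

namespace PercRepro.Shadow

open Finset PerFlat ThmH

/-- `cntFat 6 2 s > 0` for `7 ≤ s ≤ 13`. -/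
theorem cntFat_six_two_pos : ∀ s, 7 ≤ s → s ≤ 13 → 0 < cntFat 6 2 s := by
  intro s h1 h2
  unfold cntFat
  interval_cases s <;> norm_num [Nat.choose_eq_descFactorial_div_factorial, Nat.descFactorial, Nat.factorial]

/-- The count sum of the cell `(3, 0)` at `n = 10` with the count `cntFat` and the fatBudget `E = 37 / 180`: `1.546 ≥ 1`. -/
theorem countSum_three_zero_ten_b1 :
    1 ≤ countSum 10 6 3 (cPrimeDGP 5 3 6 0 2) (37 / 180 : ℚ) (cntFat 6 2) := by
  rw [cPrimeDGP_three_zero_two]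
  unfold countSum DGenP.cjG cntFat
  rw [show Finset.Icc 1 (10 - 6) = {1, 2, 3, 4} by decide]
  repeat rw [Finset.sum_insert (by decide)]
  rw [Finset.sum_singleton]
  norm_num [Nat.choose_eq_descFactorial_div_factorial, Nat.descFactorial, Nat.factorial]

/-- The count sum of the cell `(3, 0)` at `n = 11` with the count `cntFat` and the fatBudget `E = 37 / 180`: `1.130 ≥ 1`. -/
theorem countSum_three_zero_eleven_b1 :
    1 ≤ countSum 11 6 3 (cPrimeDGP 5 3 6 0 2) (37 / 180 : ℚ) (cntFat 6 2) := by
  rw [cPrimeDGP_three_zero_two]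
  unfold countSum DGenP.cjG cntFat
  rw [show Finset.Icc 1 (11 - 6) = {1, 2, 3, 4, 5} by decide]
  repeat rw [Finset.sum_insert (by decide)]
  rw [Finset.sum_singleton]
  norm_num [Nat.choose_eq_descFactorial_div_factorial, Nat.descFactorial, Nat.factorial]

/-- The count sum of the cell `(3, 0)` at `n = 12` with the count `cntFat` and the fatBudget `E = 37 / 180`: `1.027 ≥ 1`. -/
theorem countSum_three_zero_twelve_b1 :
    1 ≤ countSum 12 6 3 (cPrimeDGP 5 3 6 0 2) (37 / 180 : ℚ) (cntFat 6 2) := by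
  rw [cPrimeDGP_three_zero_two]
  unfold countSum DGenP.cjG cntFat
  rw [show Finset.Icc 1 (12 - 6) = {1, 2, 3, 4, 5, 6} by decide]
  repeat rw [Finset.sum_insert (by decide)]
  rw [Finset.sum_singleton]
  norm_num [Nat.choose_eq_descFactorial_div_factorial, Nat.descFactorial, Nat.factorial]

/-- The count sum of the cell `(3, 0)` at `n = 13` with the count `cntFat` and the fatBudget `E = 37 / 180`: `1.108 ≥ 1`. -/
theorem countSum_three_zero_thirteen_b1 :
    1 ≤ countSum 13 6 3 (cPrimeDGP 5 3 6 0 2) (37 / 180 : ℚ) (cntFat 6 2) := by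
  rw [cPrimeDGP_three_zero_two]
  unfold countSum DGenP.cjG cntFat
  rw [show Finset.Icc 1 (13 - 6) = {1, 2, 3, 4, 5, 6, 7} by decide]
  repeat rw [Finset.sum_insert (by decide)]
  rw [Finset.sum_singleton]
  norm_num [Nat.choose_eq_descFactorial_div_factorial, Nat.descFactorial, Nat.factorial]

/-- The count sum of the cell `(3, 0)` at `n = 10` with the count `cntTwo` and the fatBudget `E = 29 / 90`: `1.029 ≥ 1`. -/
theorem countSum_three_zero_ten_b4 :
    1 ≤ countSum 10 6 3 (cPrimeDGP 5 3 6 0 2) (29 / 90 : ℚ) (cntTwo 6) := by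
  rw [cPrimeDGP_three_zero_two]
  unfold countSum DGenP.cjG cntTwo
  rw [show Finset.Icc 1 (10 - 6) = {1, 2, 3, 4} by decide]
  repeat rw [Finset.sum_insert (by decide)]
  rw [Finset.sum_singleton]
  norm_num [Nat.choose_eq_descFactorial_div_factorial, Nat.descFactorial, Nat.factorial]

/-- The count sum of the cell `(3, 0)` at `n = 11` with the count `cntTwo` and the fatBudget `E = 11 / 45`: `1.016 ≥ 1`. -/
theorem countSum_three_zero_eleven_b2 :
    1 ≤ countSum 11 6 3 (cPrimeDGP 5 3 6 0 2) (11 / 45 : ℚ) (cntTwo 6) := by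
  rw [cPrimeDGP_three_zero_two]
  unfold countSum DGenP.cjG cntTwo
  rw [show Finset.Icc 1 (11 - 6) = {1, 2, 3, 4, 5} by decide]
  repeat rw [Finset.sum_insert (by decide)]
  rw [Finset.sum_singleton]
  norm_num [Nat.choose_eq_descFactorial_div_factorial, Nat.descFactorial, Nat.factorial]

variable {α : Type*} [DecidableEq α] {M : Matroid α} [M.Finite]

open scoped Classical in
/-- **The cell `(3, 0)` at `|G| = 10` with a fat thin member and at most ONE fat thin closure**: (LI_G) through the
one-hyperplane count and the fatBudget `37 / 180`. -/
theorem localShadowHall_three_zero_six_ten_of_oneFatClosure {G : Finset α} (hG : G ∈ flatsQ M (5 + 1))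
    (hd : (gr M \ G).card = 3) (hk : kColoops M G = 0)
    (hs : ∀ e ∈ gr M, ∀ f ∈ gr M, e ≠ f → rkN M {e, f} = 2) (hl : ∀ e ∈ gr M, M.Indep {e})
    (hn : G.card = 10) {B₀ : Finset α} (hB₀ : B₀ ∈ thinMembers M 5 G) (hfat : (G \ clF M B₀).card ≤ 2)
    (hcl : (fatClosures M 5 G 2).card ≤ 1) :
    LocalShadowHall M 5 G := by
  have hk' : kColoops M G + 6 = 5 + 1 := by omega
  have hd' : (gr M \ G).card ≤ 5 := by omega
  have hm2 : ∀ B ∈ thinMembers M 5 G, 6 ≤ (B \ coloops M G).card → 2 ≤ (G \ clF M B).card :=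
    fun B hB _ => two_le_card_sdiff_of_not_lay0 hG hd' (mem_thinMembers.1 hB).1 (mem_thinMembers.1 hB).2
  have hc2 : 0 ≤ cPrimeDGP 5 3 6 (kColoops M G) 2 := by
    rw [hk]; unfold cPrimeDGP capDG reqDGP phiQ; norm_num
  have hn' : G.card - kColoops M G = 10 := by omega
  have hB' : B₀ ∈ membersIn M (Uq M (5 + 2) 5) G := (mem_thinMembers.1 hB₀).1
  have hBU : B₀ ∈ Uq M (5 + 2) 5 := (mem_membersIn.1 hB').1
  have hKH : coloops M G ⊆ clF M B₀ :=
    (coloops_subset_of_mem_thinMembers hG hd' hB₀).trans (subset_clF hBU)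
  have hH : M.eRk ((clF M B₀ : Finset α) : Set α) ≤ ((5 : ℕ) : ℕ∞) := by
    rw [coe_clF, M.eRk_closure_eq, (mem_Uq.1 hBU).2.1]
  refine localShadowHall_excess_of_count (d := 3) (ρ := 6) (m₁ := 2) hG hd (by norm_num) hk' (by norm_num)
    hs hl hc2 hm2 (E := (37 / 180 : ℚ)) (by norm_num) ?_ (cnt := cntFat 6 2) ?_ ?_ ?_
  · intro S _ T hT
    have hT' : T ∈ (S \ coloops M G).powersetCard 6 := by
      unfold coverBases at hT
      exact (Finset.mem_filter.1 hT).1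
    have h := sum_faceLoss_budget_union_le (k := 1) hG hd (by norm_num) hk' hk (by norm_num)
      (by rw [fatBudget_three_zero_one]; norm_num) hcl hT'
    rw [fatBudget_three_zero_one] at h
    exact h
  · intro s h1 h2
    rw [hn'] at h2
    exact cntFat_six_two_pos s h1 (by omega)
  · intro S hSG
    have h := card_coverBases_le_of_fat hk' hKH hH hfat hSG
    unfold cntFat
    have h' : ((coverBases M G S 6).card : ℚ) + (((S \ coloops M G).card - 2).choose 6 : ℚ) ≤
        ((S \ coloops M G).card.choose 6 : ℚ) := by exact_mod_cast h
    linarith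
  · rw [hn', hk]
    exact countSum_three_zero_ten_b1

open scoped Classical in
/-- **The cell `(3, 0)` at `|G| = 11` with a fat thin member and at most ONE fat thin closure**: (LI_G) through the
one-hyperplane count and the fatBudget `37 / 180`. -/
theorem localShadowHall_three_zero_six_eleven_of_oneFatClosure {G : Finset α} (hG : G ∈ flatsQ M (5 + 1))
    (hd : (gr M \ G).card = 3) (hk : kColoops M G = 0)
    (hs : ∀ e ∈ gr M, ∀ f ∈ gr M, e ≠ f → rkN M {e, f} = 2) (hl : ∀ e ∈ gr M, M.Indep {e})
    (hn : G.card = 11) {B₀ : Finset α} (hB₀ : B₀ ∈ thinMembers M 5 G) (hfat : (G \ clF M B₀).card ≤ 2)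
    (hcl : (fatClosures M 5 G 2).card ≤ 1) :
    LocalShadowHall M 5 G := by
  have hk' : kColoops M G + 6 = 5 + 1 := by omega
  have hd' : (gr M \ G).card ≤ 5 := by omega
  have hm2 : ∀ B ∈ thinMembers M 5 G, 6 ≤ (B \ coloops M G).card → 2 ≤ (G \ clF M B).card :=
    fun B hB _ => two_le_card_sdiff_of_not_lay0 hG hd' (mem_thinMembers.1 hB).1 (mem_thinMembers.1 hB).2
  have hc2 : 0 ≤ cPrimeDGP 5 3 6 (kColoops M G) 2 := by
    rw [hk]; unfold cPrimeDGP capDG reqDGP phiQ; norm_num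
  have hn' : G.card - kColoops M G = 11 := by omega
  have hB' : B₀ ∈ membersIn M (Uq M (5 + 2) 5) G := (mem_thinMembers.1 hB₀).1
  have hBU : B₀ ∈ Uq M (5 + 2) 5 := (mem_membersIn.1 hB').1
  have hKH : coloops M G ⊆ clF M B₀ :=
    (coloops_subset_of_mem_thinMembers hG hd' hB₀).trans (subset_clF hBU)
  have hH : M.eRk ((clF M B₀ : Finset α) : Set α) ≤ ((5 : ℕ) : ℕ∞) := by
    rw [coe_clF, M.eRk_closure_eq, (mem_Uq.1 hBU).2.1]
  refine localShadowHall_excess_of_count (d := 3) (ρ := 6) (m₁ := 2) hG hd (by norm_num) hk' (by norm_num)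
    hs hl hc2 hm2 (E := (37 / 180 : ℚ)) (by norm_num) ?_ (cnt := cntFat 6 2) ?_ ?_ ?_
  · intro S _ T hT
    have hT' : T ∈ (S \ coloops M G).powersetCard 6 := by
      unfold coverBases at hT
      exact (Finset.mem_filter.1 hT).1
    have h := sum_faceLoss_budget_union_le (k := 1) hG hd (by norm_num) hk' hk (by norm_num)
      (by rw [fatBudget_three_zero_one]; norm_num) hcl hT'
    rw [fatBudget_three_zero_one] at h
    exact h
  · intro s h1 h2
    rw [hn'] at h2
    exact cntFat_six_two_pos s h1 (by omega)
  · intro S hSG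
    have h := card_coverBases_le_of_fat hk' hKH hH hfat hSG
    unfold cntFat
    have h' : ((coverBases M G S 6).card : ℚ) + (((S \ coloops M G).card - 2).choose 6 : ℚ) ≤
        ((S \ coloops M G).card.choose 6 : ℚ) := by exact_mod_cast h
    linarith
  · rw [hn', hk]
    exact countSum_three_zero_eleven_b1

open scoped Classical in
/-- **The cell `(3, 0)` at `|G| = 12` with a fat thin member and at most ONE fat thin closure**: (LI_G) through the
one-hyperplane count and the fatBudget `37 / 180`. -/
theorem localShadowHall_three_zero_six_twelve_of_oneFatClosure {G : Finset α} (hG : G ∈ flatsQ M (5 + 1))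
    (hd : (gr M \ G).card = 3) (hk : kColoops M G = 0)
    (hs : ∀ e ∈ gr M, ∀ f ∈ gr M, e ≠ f → rkN M {e, f} = 2) (hl : ∀ e ∈ gr M, M.Indep {e})
    (hn : G.card = 12) {B₀ : Finset α} (hB₀ : B₀ ∈ thinMembers M 5 G) (hfat : (G \ clF M B₀).card ≤ 2)
    (hcl : (fatClosures M 5 G 2).card ≤ 1) :
    LocalShadowHall M 5 G := by
  have hk' : kColoops M G + 6 = 5 + 1 := by omega
  have hd' : (gr M \ G).card ≤ 5 := by omega
  have hm2 : ∀ B ∈ thinMembers M 5 G, 6 ≤ (B \ coloops M G).card → 2 ≤ (G \ clF M B).card :=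
    fun B hB _ => two_le_card_sdiff_of_not_lay0 hG hd' (mem_thinMembers.1 hB).1 (mem_thinMembers.1 hB).2
  have hc2 : 0 ≤ cPrimeDGP 5 3 6 (kColoops M G) 2 := by
    rw [hk]; unfold cPrimeDGP capDG reqDGP phiQ; norm_num
  have hn' : G.card - kColoops M G = 12 := by omega
  have hB' : B₀ ∈ membersIn M (Uq M (5 + 2) 5) G := (mem_thinMembers.1 hB₀).1
  have hBU : B₀ ∈ Uq M (5 + 2) 5 := (mem_membersIn.1 hB').1
  have hKH : coloops M G ⊆ clF M B₀ :=
    (coloops_subset_of_mem_thinMembers hG hd' hB₀).trans (subset_clF hBU)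
  have hH : M.eRk ((clF M B₀ : Finset α) : Set α) ≤ ((5 : ℕ) : ℕ∞) := by
    rw [coe_clF, M.eRk_closure_eq, (mem_Uq.1 hBU).2.1]
  refine localShadowHall_excess_of_count (d := 3) (ρ := 6) (m₁ := 2) hG hd (by norm_num) hk' (by norm_num)
    hs hl hc2 hm2 (E := (37 / 180 : ℚ)) (by norm_num) ?_ (cnt := cntFat 6 2) ?_ ?_ ?_
  · intro S _ T hT
    have hT' : T ∈ (S \ coloops M G).powersetCard 6 := by
      unfold coverBases at hT
      exact (Finset.mem_filter.1 hT).1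
    have h := sum_faceLoss_budget_union_le (k := 1) hG hd (by norm_num) hk' hk (by norm_num)
      (by rw [fatBudget_three_zero_one]; norm_num) hcl hT'
    rw [fatBudget_three_zero_one] at h
    exact h
  · intro s h1 h2
    rw [hn'] at h2
    exact cntFat_six_two_pos s h1 (by omega)
  · intro S hSG
    have h := card_coverBases_le_of_fat hk' hKH hH hfat hSG
    unfold cntFat
    have h' : ((coverBases M G S 6).card : ℚ) + (((S \ coloops M G).card - 2).choose 6 : ℚ) ≤
        ((S \ coloops M G).card.choose 6 : ℚ) := by exact_mod_cast h
    linarith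
  · rw [hn', hk]
    exact countSum_three_zero_twelve_b1

open scoped Classical in
/-- **The cell `(3, 0)` at `|G| = 13` with a fat thin member and at most ONE fat thin closure**: (LI_G) through the
one-hyperplane count and the fatBudget `37 / 180`. -/
theorem localShadowHall_three_zero_six_thirteen_of_oneFatClosure {G : Finset α} (hG : G ∈ flatsQ M (5 + 1))
    (hd : (gr M \ G).card = 3) (hk : kColoops M G = 0)
    (hs : ∀ e ∈ gr M, ∀ f ∈ gr M, e ≠ f → rkN M {e, f} = 2) (hl : ∀ e ∈ gr M, M.Indep {e})
    (hn : G.card = 13) {B₀ : Finset α} (hB₀ : B₀ ∈ thinMembers M 5 G) (hfat : (G \ clF M B₀).card ≤ 2)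
    (hcl : (fatClosures M 5 G 2).card ≤ 1) :
    LocalShadowHall M 5 G := by
  have hk' : kColoops M G + 6 = 5 + 1 := by omega
  have hd' : (gr M \ G).card ≤ 5 := by omega
  have hm2 : ∀ B ∈ thinMembers M 5 G, 6 ≤ (B \ coloops M G).card → 2 ≤ (G \ clF M B).card :=
    fun B hB _ => two_le_card_sdiff_of_not_lay0 hG hd' (mem_thinMembers.1 hB).1 (mem_thinMembers.1 hB).2
  have hc2 : 0 ≤ cPrimeDGP 5 3 6 (kColoops M G) 2 := by
    rw [hk]; unfold cPrimeDGP capDG reqDGP phiQ; norm_num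
  have hn' : G.card - kColoops M G = 13 := by omega
  have hB' : B₀ ∈ membersIn M (Uq M (5 + 2) 5) G := (mem_thinMembers.1 hB₀).1
  have hBU : B₀ ∈ Uq M (5 + 2) 5 := (mem_membersIn.1 hB').1
  have hKH : coloops M G ⊆ clF M B₀ :=
    (coloops_subset_of_mem_thinMembers hG hd' hB₀).trans (subset_clF hBU)
  have hH : M.eRk ((clF M B₀ : Finset α) : Set α) ≤ ((5 : ℕ) : ℕ∞) := by
    rw [coe_clF, M.eRk_closure_eq, (mem_Uq.1 hBU).2.1]
  refine localShadowHall_excess_of_count (d := 3) (ρ := 6) (m₁ := 2) hG hd (by norm_num) hk' (by norm_num)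
    hs hl hc2 hm2 (E := (37 / 180 : ℚ)) (by norm_num) ?_ (cnt := cntFat 6 2) ?_ ?_ ?_
  · intro S _ T hT
    have hT' : T ∈ (S \ coloops M G).powersetCard 6 := by
      unfold coverBases at hT
      exact (Finset.mem_filter.1 hT).1
    have h := sum_faceLoss_budget_union_le (k := 1) hG hd (by norm_num) hk' hk (by norm_num)
      (by rw [fatBudget_three_zero_one]; norm_num) hcl hT'
    rw [fatBudget_three_zero_one] at h
    exact h
  · intro s h1 h2
    rw [hn'] at h2
    exact cntFat_six_two_pos s h1 (by omega)
  · intro S hSG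
    have h := card_coverBases_le_of_fat hk' hKH hH hfat hSG
    unfold cntFat
    have h' : ((coverBases M G S 6).card : ℚ) + (((S \ coloops M G).card - 2).choose 6 : ℚ) ≤
        ((S \ coloops M G).card.choose 6 : ℚ) := by exact_mod_cast h
    linarith
  · rw [hn', hk]
    exact countSum_three_zero_thirteen_b1

open scoped Classical in
/-- **The cell `(3, 0)` at `|G| = 10` with two fat thin members missing DIFFERENT sets and at most 4 fat thin
closures**: (LI_G) through the two-hyperplane count and the fatBudget `29 / 90`. -/
theorem localShadowHall_three_zero_six_ten_of_twoFat_b4 {G : Finset α} (hG : G ∈ flatsQ M (5 + 1))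
    (hd : (gr M \ G).card = 3) (hk : kColoops M G = 0)
    (hs : ∀ e ∈ gr M, ∀ f ∈ gr M, e ≠ f → rkN M {e, f} = 2) (hl : ∀ e ∈ gr M, M.Indep {e})
    (hn : G.card = 10) {B₀ B₁ : Finset α} (hB₀ : B₀ ∈ thinMembers M 5 G) (hB₁ : B₁ ∈ thinMembers M 5 G)
    (hfat₀ : (G \ clF M B₀).card ≤ 2) (hfat₁ : (G \ clF M B₁).card ≤ 2)
    (hne : G \ clF M B₀ ≠ G \ clF M B₁) (hcl : (fatClosures M 5 G 2).card ≤ 4) :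
    LocalShadowHall M 5 G := by
  have hk' : kColoops M G + 6 = 5 + 1 := by omega
  have hd' : (gr M \ G).card ≤ 5 := by omega
  have hm2 : ∀ B ∈ thinMembers M 5 G, 6 ≤ (B \ coloops M G).card → 2 ≤ (G \ clF M B).card :=
    fun B hB _ => two_le_card_sdiff_of_not_lay0 hG hd' (mem_thinMembers.1 hB).1 (mem_thinMembers.1 hB).2
  have hc2 : 0 ≤ cPrimeDGP 5 3 6 (kColoops M G) 2 := by
    rw [hk]; unfold cPrimeDGP capDG reqDGP phiQ; norm_num
  have hn' : G.card - kColoops M G = 10 := by omega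
  refine localShadowHall_excess_of_count (d := 3) (ρ := 6) (m₁ := 2) hG hd (by norm_num) hk' (by norm_num)
    hs hl hc2 hm2 (E := (29 / 90 : ℚ)) (by norm_num) ?_ (cnt := cntTwo 6) ?_ ?_ ?_
  · intro S _ T hT
    have hT' : T ∈ (S \ coloops M G).powersetCard 6 := by
      unfold coverBases at hT
      exact (Finset.mem_filter.1 hT).1
    have h := sum_faceLoss_budget_union_le (k := 4) hG hd (by norm_num) hk' hk (by norm_num)
      (by rw [fatBudget_three_zero_four]; norm_num) hcl hT'
    rw [fatBudget_three_zero_four] at h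
    exact h
  · intro s h1 h2
    rw [hn'] at h2
    exact cntTwo_six_pos s h1 (by omega)
  · intro S hSG
    exact card_coverBases_le_cntTwo hk' (by norm_num) (coloops_subset_clF_of_mem_thinMembers hG hd' hB₀)
      (eRk_clF_le_of_mem_thinMembers hB₀) (coloops_subset_clF_of_mem_thinMembers hG hd' hB₁)
      (eRk_clF_le_of_mem_thinMembers hB₁) hfat₀ hfat₁ hne hSG
  · rw [hn', hk]
    exact countSum_three_zero_ten_b4

open scoped Classical in
/-- **The cell `(3, 0)` at `|G| = 11` with two fat thin members missing DIFFERENT sets and at most 2 fat thin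
closures**: (LI_G) through the two-hyperplane count and the fatBudget `11 / 45`. -/
theorem localShadowHall_three_zero_six_eleven_of_twoFat_b2 {G : Finset α} (hG : G ∈ flatsQ M (5 + 1))
    (hd : (gr M \ G).card = 3) (hk : kColoops M G = 0)
    (hs : ∀ e ∈ gr M, ∀ f ∈ gr M, e ≠ f → rkN M {e, f} = 2) (hl : ∀ e ∈ gr M, M.Indep {e})
    (hn : G.card = 11) {B₀ B₁ : Finset α} (hB₀ : B₀ ∈ thinMembers M 5 G) (hB₁ : B₁ ∈ thinMembers M 5 G)
    (hfat₀ : (G \ clF M B₀).card ≤ 2) (hfat₁ : (G \ clF M B₁).card ≤ 2)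
    (hne : G \ clF M B₀ ≠ G \ clF M B₁) (hcl : (fatClosures M 5 G 2).card ≤ 2) :
    LocalShadowHall M 5 G := by
  have hk' : kColoops M G + 6 = 5 + 1 := by omega
  have hd' : (gr M \ G).card ≤ 5 := by omega
  have hm2 : ∀ B ∈ thinMembers M 5 G, 6 ≤ (B \ coloops M G).card → 2 ≤ (G \ clF M B).card :=
    fun B hB _ => two_le_card_sdiff_of_not_lay0 hG hd' (mem_thinMembers.1 hB).1 (mem_thinMembers.1 hB).2
  have hc2 : 0 ≤ cPrimeDGP 5 3 6 (kColoops M G) 2 := by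
    rw [hk]; unfold cPrimeDGP capDG reqDGP phiQ; norm_num
  have hn' : G.card - kColoops M G = 11 := by omega
  refine localShadowHall_excess_of_count (d := 3) (ρ := 6) (m₁ := 2) hG hd (by norm_num) hk' (by norm_num)
    hs hl hc2 hm2 (E := (11 / 45 : ℚ)) (by norm_num) ?_ (cnt := cntTwo 6) ?_ ?_ ?_
  · intro S _ T hT
    have hT' : T ∈ (S \ coloops M G).powersetCard 6 := by
      unfold coverBases at hT
      exact (Finset.mem_filter.1 hT).1
    have h := sum_faceLoss_budget_union_le (k := 2) hG hd (by norm_num) hk' hk (by norm_num)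
      (by rw [fatBudget_three_zero_two]; norm_num) hcl hT'
    rw [fatBudget_three_zero_two] at h
    exact h
  · intro s h1 h2
    rw [hn'] at h2
    exact cntTwo_six_pos s h1 (by omega)
  · intro S hSG
    exact card_coverBases_le_cntTwo hk' (by norm_num) (coloops_subset_clF_of_mem_thinMembers hG hd' hB₀)
      (eRk_clF_le_of_mem_thinMembers hB₀) (coloops_subset_clF_of_mem_thinMembers hG hd' hB₁)
      (eRk_clF_le_of_mem_thinMembers hB₁) hfat₀ hfat₁ hne hSG
  · rw [hn', hk]
    exact countSum_three_zero_eleven_b2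

end PercRepro.Shadow
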